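import Summits.Ventures.PercRepro.SixFourT4Lpp

/-!
# PercRepro — C-025 at `(6,4)`, §22.4(a) part A: partner planes and the fibre bound `#{Z : cl(Z) = ψ} ≤ 2^{|λ_ψ|}` (p3, gen 8)

mine-2's `MINE2-RLS.md` §22.4(a): in a GENERIC `G` (`r(G ∖ ρ) ≥ 3` for every plane `ρ`) every `Z` counted by `X`
(`r(Z) ≤ 3`, `r(G ∖ Z) ≤ 3`) has `r(Z) = r(G ∖ Z) = 3`; `ψ = cl(Z)` and `ψ′ = cl(G ∖ Z)` are planes with
`ψ ∪ ψ′ ⊇ G` and `ψ′ = cl(G ∖ ψ)` (the PARTNER of `ψ`), and `Z = (ψ ∩ G) ∖ Y` with `Y ⊆ λ := ψ ∩ ψ′ ∩ G`, a set of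
rank `≤ 2`.  This part: `exists_plane_superset`, `eRk_eq_three_of_mem_Xset`, the fibre `fiber ψ` of the sets `Z`
with `cl(Z) = ψ`, `partner ψ := cl(G ∖ ψ)` with `clF_sdiff_eq_partner` (for `Z` in the fibre, `cl(G ∖ Z) = partner ψ`),
`card_fiber_le` (`#fiber ψ ≤ 2^{|λ_ψ|}`), `card_lambda` (`|λ_ψ| = p + p′ − g` when the fibre is nonempty),
`lambda_line` (`|λ_ψ| ≤ 1` or `λ_ψ` is the full trace of a line on `ψ ∩ G`), `partner_partner` and
`card_fiber_partner` (`Z ↦ G ∖ Z` identifies the fibres of `ψ` and of its partner).  Part B (`SixFourT4X.lean`)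
charges the fibres to the larger plane of each pair and bounds `X` by `Σ_ρ Ξ_g(ρ)` in profile form.
-/

namespace PercRepro.SixFour

open Finset ThmH

variable {α : Type*} [DecidableEq α] {M : Matroid α} [M.Finite] {G : Finset α}

/-! ## Generic sets, planes through a rank-`≤ 3` set -/

/-- `G` is GENERIC: the complement of every plane trace has rank at least `3`. -/
def Generic (M : Matroid α) [M.Finite] (G : Finset α) : Prop :=
  ∀ P ∈ planes M, 3 ≤ M.eRk ((G \ P : Finset α) : Set α)

omit [M.Finite] in
/-- A subset of `G` of rank `k < 4` extends inside `G` to a subset of rank `k + 1`. -/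
theorem exists_insert_eRk_succ (hr : M.eRk (G : Set α) = 4) {Z : Finset α} {k : ℕ}
    (hk : M.eRk (Z : Set α) = k) (hk3 : k < 4) : ∃ y ∈ G, y ∉ Z ∧ M.eRk ((insert y Z : Finset α) : Set α) = k + 1 := by
  have hlt : M.eRk (Z : Set α) < M.eRk (G : Set α) := by
    rw [hk, hr]
    exact_mod_cast hk3
  obtain ⟨y, hy, hy'⟩ := Matroid.exists_eRk_insert_eq_add_one_of_lt hlt
  rw [Set.mem_sdiff, Finset.mem_coe, Finset.mem_coe] at hy
  refine ⟨y, hy.1, hy.2, ?_⟩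
  rw [Finset.coe_insert, hy', hk]

/-- Every subset of `G` of rank at most `3` lies in a plane of `M` (`r(G) = 4`). -/
theorem exists_plane_superset (hG : G ⊆ gr M) (hr : M.eRk (G : Set α) = 4) {Z : Finset α} (hZ : Z ⊆ G)
    (h3 : M.eRk (Z : Set α) ≤ 3) : ∃ P ∈ planes M, Z ⊆ P := by
  suffices h : ∀ j : ℕ, ∀ k : ℕ, k + j = 3 → ∀ Z : Finset α, Z ⊆ G → M.eRk (Z : Set α) = (k : ℕ∞) →
      ∃ Z' : Finset α, Z ⊆ Z' ∧ Z' ⊆ G ∧ M.eRk (Z' : Set α) = 3 by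
    obtain ⟨k, hk, -⟩ := eRk_eq_nat M Z
    have hk3 : k ≤ 3 := by rw [hk] at h3; exact_mod_cast h3
    obtain ⟨Z', hZZ', hZ'G, hr3⟩ := h (3 - k) k (by omega) Z hZ hk
    obtain ⟨hP, hsub⟩ := clF_mem_planes (hZ'G.trans hG) hr3
    exact ⟨clF M Z', hP, hZZ'.trans hsub⟩
  intro j
  induction j with
  | zero =>
    intro k hk Z hZ hZk
    exact ⟨Z, Finset.Subset.refl Z, hZ, by rw [hZk]; exact_mod_cast (by omega : k = 3)⟩
  | succ j ih =>
    intro k hk Z hZ hZk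
    obtain ⟨y, hyG, -, hy⟩ := exists_insert_eRk_succ hr hZk (by omega)
    obtain ⟨Z', h1, h2, h3⟩ := ih (k + 1) (by omega) (insert y Z) (Finset.insert_subset hyG hZ) (by rw [hy]; push_cast; rfl)
    exact ⟨Z', (Finset.subset_insert y Z).trans h1, h2, h3⟩

/-! ## The sets counted by `X` in a generic `G` -/

/-- The sets counted by `X`. -/
noncomputable def Xset (M : Matroid α) [M.Finite] (G : Finset α) : Finset (Finset α) :=
  G.powerset.filter (fun Z : Finset α => M.eRk (Z : Set α) ≤ 3 ∧ M.eRk ((G \ Z : Finset α) : Set α) ≤ 3)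

/-- `Xcnt = #Xset`. -/
theorem Xcnt_eq_card_Xset : Xcnt M G = (Xset M G).card := rfl

/-- Membership in `Xset`. -/
theorem mem_Xset {Z : Finset α} :
    Z ∈ Xset M G ↔ Z ⊆ G ∧ M.eRk (Z : Set α) ≤ 3 ∧ M.eRk ((G \ Z : Finset α) : Set α) ≤ 3 := by
  unfold Xset
  rw [Finset.mem_filter, Finset.mem_powerset]

/-- In a generic `G`, every `Z` counted by `X` has `r(Z) = 3`. -/
theorem eRk_eq_three_of_mem_Xset (hG : G ⊆ gr M) (hr : M.eRk (G : Set α) = 4) (hgen : Generic M G)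
    {Z : Finset α} (hZ : Z ∈ Xset M G) : M.eRk (Z : Set α) = 3 := by
  obtain ⟨hZG, hZ3, hZc⟩ := mem_Xset.1 hZ
  obtain ⟨P, hP, hsub⟩ := exists_plane_superset hG hr Finset.sdiff_subset hZc
  have hsub' : G \ P ⊆ Z := by
    intro y hy
    rw [Finset.mem_sdiff] at hy
    by_contra hyZ
    exact hy.2 (hsub (Finset.mem_sdiff.2 ⟨hy.1, hyZ⟩))
  exact le_antisymm hZ3 ((hgen P hP).trans (M.eRk_mono (Finset.coe_subset.2 hsub')))

/-- The complement of a set counted by `X` is counted by `X`. -/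
theorem sdiff_mem_Xset {Z : Finset α} (hZ : Z ∈ Xset M G) : G \ Z ∈ Xset M G := by
  obtain ⟨hZG, hZ3, hZc⟩ := mem_Xset.1 hZ
  rw [mem_Xset]
  refine ⟨Finset.sdiff_subset, hZc, ?_⟩
  rwa [Finset.sdiff_sdiff_eq_self hZG]

/-! ## Fibres over planes, the partner plane -/

/-- The fibre of the plane `ψ`: the sets counted by `X` whose closure is `ψ`. -/
noncomputable def fiber (M : Matroid α) [M.Finite] (G P : Finset α) : Finset (Finset α) :=
  (Xset M G).filter (fun Z : Finset α => clF M Z = P)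

/-- The partner of a plane `ψ`: the closure of `G ∖ ψ`. -/
noncomputable def partner (M : Matroid α) [M.Finite] (G P : Finset α) : Finset α := clF M (G \ P)

/-- `λ_ψ := ψ ∩ partner(ψ) ∩ G`. -/
noncomputable def lambda (M : Matroid α) [M.Finite] (G P : Finset α) : Finset α := P ∩ partner M G P ∩ G

/-- `X = Σ_ψ #fiber ψ`. -/
theorem card_Xset_eq_sum_fiber (hG : G ⊆ gr M) (hr : M.eRk (G : Set α) = 4) (hgen : Generic M G) :
    (Xset M G).card = ∑ P ∈ planes M, (fiber M G P).card := by
  refine Finset.card_eq_sum_card_fiberwise (fun Z hZ => ?_)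
  have h3 := eRk_eq_three_of_mem_Xset hG hr hgen hZ
  exact (clF_mem_planes ((mem_Xset.1 hZ).1.trans hG) h3).1

/-- For `Z` in the fibre of `ψ`: `Z ⊆ ψ ∩ G`, `cl(G ∖ Z) = partner ψ` is a plane, `G ∖ Z ⊆ partner ψ`, and
`r(G ∖ ψ) = 3`. -/
theorem fiber_facts (hG : G ⊆ gr M) (hr : M.eRk (G : Set α) = 4) (hgen : Generic M G) {P Z : Finset α}
    (hP : P ∈ planes M) (hZ : Z ∈ fiber M G P) :
    Z ⊆ P ∩ G ∧ partner M G P ∈ planes M ∧ clF M (G \ Z) = partner M G P ∧ G \ Z ⊆ partner M G P ∧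
      M.eRk ((G \ P : Finset α) : Set α) = 3 := by
  unfold fiber at hZ
  obtain ⟨hZX, hcl⟩ := Finset.mem_filter.1 hZ
  obtain ⟨hZG, -, -⟩ := mem_Xset.1 hZX
  have hZ3 := eRk_eq_three_of_mem_Xset hG hr hgen hZX
  have hZc3 := eRk_eq_three_of_mem_Xset hG hr hgen (sdiff_mem_Xset hZX)
  obtain ⟨hP', hsub'⟩ := clF_mem_planes (Finset.sdiff_subset.trans hG) hZc3
  have hZP : Z ⊆ P := by
    rw [← hcl]
    exact (clF_mem_planes (hZG.trans hG) hZ3).2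
  -- `G ∖ ψ ⊆ G ∖ Z`, rank `3` by genericity, closure = `cl(G ∖ Z)`
  have hsub : G \ P ⊆ G \ Z := Finset.sdiff_subset_sdiff (Finset.Subset.refl G) hZP
  have hr3 : M.eRk ((G \ P : Finset α) : Set α) = 3 :=
    le_antisymm ((M.eRk_mono (Finset.coe_subset.2 hsub)).trans hZc3.le) (hgen P hP)
  have hpart : partner M G P = clF M (G \ Z) := by
    unfold partner
    apply Finset.coe_injective
    rw [coe_clF, coe_clF]
    exact closure_eq_of_subset_flat (M.isFlat_closure _)
      ((M.subset_closure_of_subset' (Finset.coe_subset.2 hsub) (by rw [← coe_gr M]; exact Finset.coe_subset.2 (Finset.sdiff_subset.trans hG))))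
      (Finset.finite_toSet _) (by rw [M.eRk_closure_eq, hZc3, hr3])
  refine ⟨Finset.subset_inter hZP hZG, by rw [hpart]; exact hP', hpart.symm, by rw [hpart]; exact hsub', hr3⟩

/-- The fibre of `ψ` injects into the subsets of `λ_ψ` via `Z ↦ (ψ ∩ G) ∖ Z`: `#fiber ψ ≤ 2^{|λ_ψ|}`. -/
theorem card_fiber_le (hG : G ⊆ gr M) (hr : M.eRk (G : Set α) = 4) (hgen : Generic M G) {P : Finset α}
    (hP : P ∈ planes M) : (fiber M G P).card ≤ 2 ^ (lambda M G P).card := by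
  rw [← Finset.card_powerset]
  refine Finset.card_le_card_of_injOn (fun Z => (P ∩ G) \ Z) ?_ ?_
  · intro Z hZ
    rw [Finset.mem_coe] at hZ
    obtain ⟨hZsub, -, -, hcomp, -⟩ := fiber_facts hG hr hgen hP hZ
    rw [Finset.mem_coe, Finset.mem_powerset]
    intro y hy
    rw [Finset.mem_sdiff, Finset.mem_inter] at hy
    unfold lambda
    rw [Finset.mem_inter, Finset.mem_inter]
    exact ⟨⟨hy.1.1, hcomp (Finset.mem_sdiff.2 ⟨hy.1.2, hy.2⟩)⟩, hy.1.2⟩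
  · intro Z₁ hZ₁ Z₂ hZ₂ heq
    rw [Finset.mem_coe] at hZ₁ hZ₂
    have h₁ := (fiber_facts hG hr hgen hP hZ₁).1
    have h₂ := (fiber_facts hG hr hgen hP hZ₂).1
    have heq' : (P ∩ G) \ Z₁ = (P ∩ G) \ Z₂ := heq
    have := congrArg (fun S => (P ∩ G) \ S) heq'
    simpa only [Finset.sdiff_sdiff_eq_self h₁, Finset.sdiff_sdiff_eq_self h₂] using this

/-- When the fibre of `ψ` is nonempty, `|λ_ψ| + g = |ψ ∩ G| + |partner ψ ∩ G|`. -/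
theorem card_lambda (hG : G ⊆ gr M) (hr : M.eRk (G : Set α) = 4) (hgen : Generic M G) {P : Finset α}
    (hP : P ∈ planes M) (hne : (fiber M G P).Nonempty) :
    (lambda M G P).card + G.card = (P ∩ G).card + (partner M G P ∩ G).card := by
  obtain ⟨Z, hZ⟩ := hne
  obtain ⟨hZsub, -, -, hcomp, -⟩ := fiber_facts hG hr hgen hP hZ
  have hunion : (P ∩ G) ∪ (partner M G P ∩ G) = G := by
    apply Finset.Subset.antisymm
    · exact Finset.union_subset Finset.inter_subset_right Finset.inter_subset_right
    · intro y hy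
      rw [Finset.mem_union, Finset.mem_inter, Finset.mem_inter]
      by_cases hyZ : y ∈ Z
      · exact Or.inl ⟨(Finset.mem_inter.1 (hZsub hyZ)).1, hy⟩
      · exact Or.inr ⟨hcomp (Finset.mem_sdiff.2 ⟨hy, hyZ⟩), hy⟩
  have h := Finset.card_union_add_card_inter (P ∩ G) (partner M G P ∩ G)
  rw [hunion] at h
  have hl : (P ∩ G) ∩ (partner M G P ∩ G) = lambda M G P := by
    unfold lambda
    ext y
    simp only [Finset.mem_inter]
    tauto
  rw [hl] at h
  omega

/-- `λ_ψ` has rank at most `2` when the fibre is nonempty (`ψ ≠ partner ψ`). -/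
theorem eRk_lambda_le_two (hG : G ⊆ gr M) (hr : M.eRk (G : Set α) = 4) (hgen : Generic M G) {P : Finset α}
    (hP : P ∈ planes M) (hne : (fiber M G P).Nonempty) : M.eRk ((lambda M G P : Finset α) : Set α) ≤ 2 := by
  obtain ⟨Z, hZ⟩ := hne
  obtain ⟨hZsub, hP', -, hcomp, -⟩ := fiber_facts hG hr hgen hP hZ
  have hne' : P ≠ partner M G P := by
    intro heq
    -- then `G ⊆ ψ`, contradicting `r(G) = 4`
    have hsub : G ⊆ P := by
      intro y hy
      by_cases hyZ : y ∈ Z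
      · exact (Finset.mem_inter.1 (hZsub hyZ)).1
      · rw [heq]; exact hcomp (Finset.mem_sdiff.2 ⟨hy, hyZ⟩)
    have := M.eRk_mono (Finset.coe_subset.2 hsub)
    rw [hr, (mem_planes.1 hP).2.2] at this
    exact absurd this (by decide)
  have h2 := eRk_inter_le_two_of_ne hP hP' hne'
  refine le_trans (M.eRk_mono (Finset.coe_subset.2 ?_)) h2
  unfold lambda
  exact Finset.inter_subset_left

/-- `λ_ψ` is small (`≤ 1` point) or the full trace of a line on `ψ ∩ G` (`inc (ψ ∩ G) |λ_ψ| ≥ 1`). -/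
theorem lambda_line (hs : Simple M) (hG : G ⊆ gr M) (hr : M.eRk (G : Set α) = 4) (hgen : Generic M G)
    {P : Finset α} (hP : P ∈ planes M) (hne : (fiber M G P).Nonempty) :
    (lambda M G P).card ≤ 1 ∨ 1 ≤ inc M (P ∩ G) (lambda M G P).card := by
  by_cases hc : (lambda M G P).card ≤ 1
  · exact Or.inl hc
  · right
    have hlamG : lambda M G P ⊆ G := by unfold lambda; exact Finset.inter_subset_right
    have hr2 : M.eRk ((lambda M G P : Finset α) : Set α) = 2 :=
      le_antisymm (eRk_lambda_le_two hG hr hgen hP hne) (two_le_eRk_of_two_le_card hs hG hlamG (by omega))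
    obtain ⟨hL, hlamL⟩ := clF_mem_lines (hlamG.trans hG) hr2
    -- the line `cl(λ)` lies in both planes, so its trace on `ψ ∩ G` is exactly `λ`
    have hlamP : lambda M G P ⊆ P := by
      unfold lambda; exact Finset.inter_subset_left.trans Finset.inter_subset_left
    have hlamP' : lambda M G P ⊆ partner M G P := by
      unfold lambda; exact Finset.inter_subset_left.trans Finset.inter_subset_right
    have hLP : clF M (lambda M G P) ⊆ P := by
      rw [← Finset.coe_subset, coe_clF]
      have := M.closure_subset_closure (Finset.coe_subset.2 hlamP)
      rwa [(mem_planes.1 hP).2.1.closure] at this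
    have hLP' : clF M (lambda M G P) ⊆ partner M G P := by
      obtain ⟨Z, hZ⟩ := hne
      obtain ⟨-, hP', -, -, -⟩ := fiber_facts hG hr hgen hP hZ
      rw [← Finset.coe_subset, coe_clF]
      have := M.closure_subset_closure (Finset.coe_subset.2 hlamP')
      rwa [(mem_planes.1 hP').2.1.closure] at this
    have htrace : clF M (lambda M G P) ∩ (P ∩ G) = lambda M G P := by
      apply Finset.Subset.antisymm
      · intro y hy
        rw [Finset.mem_inter, Finset.mem_inter] at hy
        unfold lambda
        rw [Finset.mem_inter, Finset.mem_inter]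
        exact ⟨⟨hy.2.1, hLP' hy.1⟩, hy.2.2⟩
      · exact Finset.subset_inter hlamL (Finset.subset_inter hlamP hlamG)
    unfold inc
    refine Finset.card_pos.2 ⟨clF M (lambda M G P), ?_⟩
    rw [Finset.mem_filter]
    exact ⟨hL, by rw [htrace]⟩

/-- The partner of the partner of a plane with nonempty fibre is the plane itself. -/
theorem partner_partner (hG : G ⊆ gr M) (hr : M.eRk (G : Set α) = 4) (hgen : Generic M G) {P : Finset α}
    (hP : P ∈ planes M) (hne : (fiber M G P).Nonempty) : partner M G (partner M G P) = P := by
  obtain ⟨Z, hZ⟩ := hne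
  obtain ⟨hZsub, hP', hcl, hcomp, -⟩ := fiber_facts hG hr hgen hP hZ
  have hcl' : clF M Z = P := (Finset.mem_filter.1 hZ).2
  have hZ3 : M.eRk (Z : Set α) = 3 := eRk_eq_three_of_mem_Xset hG hr hgen (Finset.mem_filter.1 hZ).1
  -- `G ∖ partner ψ ⊆ Z`, of rank `≥ 3` by genericity, so its closure is `cl(Z) = ψ`
  have hsub : G \ partner M G P ⊆ Z := by
    intro y hy
    rw [Finset.mem_sdiff] at hy
    by_contra hyZ
    exact hy.2 (hcomp (Finset.mem_sdiff.2 ⟨hy.1, hyZ⟩))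
  have hr3 : M.eRk ((G \ partner M G P : Finset α) : Set α) = 3 :=
    le_antisymm ((M.eRk_mono (Finset.coe_subset.2 hsub)).trans hZ3.le) (hgen _ hP')
  have key : clF M (G \ partner M G P) = clF M Z := by
    apply Finset.coe_injective
    rw [coe_clF, coe_clF]
    exact closure_eq_of_subset_flat (M.isFlat_closure _)
      (M.subset_closure_of_subset' (Finset.coe_subset.2 hsub) (by rw [← coe_gr M]; exact Finset.coe_subset.2 (Finset.sdiff_subset.trans hG)))
      (Finset.finite_toSet _) (by rw [M.eRk_closure_eq, hZ3, hr3])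
  show clF M (G \ partner M G P) = P
  rw [key, hcl']

/-- `Z ↦ G ∖ Z` maps the fibre of `ψ` into the fibre of its partner. -/
theorem sdiff_mem_fiber_partner (hG : G ⊆ gr M) (hr : M.eRk (G : Set α) = 4) (hgen : Generic M G) {P Z : Finset α}
    (hP : P ∈ planes M) (hZ : Z ∈ fiber M G P) : G \ Z ∈ fiber M G (partner M G P) := by
  obtain ⟨-, -, hcl, -, -⟩ := fiber_facts hG hr hgen hP hZ
  unfold fiber
  exact Finset.mem_filter.2 ⟨sdiff_mem_Xset (Finset.mem_filter.1 hZ).1, hcl⟩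

/-- The fibres of `ψ` and of its partner have the same size (when the fibre of `ψ` is nonempty). -/
theorem card_fiber_partner (hG : G ⊆ gr M) (hr : M.eRk (G : Set α) = 4) (hgen : Generic M G) {P : Finset α}
    (hP : P ∈ planes M) (hne : (fiber M G P).Nonempty) : (fiber M G (partner M G P)).card = (fiber M G P).card := by
  have hP' : partner M G P ∈ planes M := by
    obtain ⟨Z, hZ⟩ := hne
    exact (fiber_facts hG hr hgen hP hZ).2.1
  have hpp := partner_partner hG hr hgen hP hne
  refine Finset.card_nbij' (fun Z => G \ Z) (fun Z => G \ Z) ?_ ?_ ?_ ?_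
  · intro Z hZ
    rw [Finset.mem_coe] at hZ ⊢
    have := sdiff_mem_fiber_partner hG hr hgen hP' hZ
    rwa [hpp] at this
  · intro Z hZ
    rw [Finset.mem_coe] at hZ ⊢
    exact sdiff_mem_fiber_partner hG hr hgen hP hZ
  · intro Z hZ
    rw [Finset.mem_coe] at hZ
    exact Finset.sdiff_sdiff_eq_self (mem_Xset.1 (Finset.mem_filter.1 hZ).1).1
  · intro Z hZ
    rw [Finset.mem_coe] at hZ
    exact Finset.sdiff_sdiff_eq_self (mem_Xset.1 (Finset.mem_filter.1 hZ).1).1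

end PercRepro.SixFour
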